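import Summits.BirchSwinnertonDyer.BirchSwinnertonDyer.Theorems.PrintCf2RubinValueTwoKatzMeasureJZeroSeamBookkeeping
import Summits.BirchSwinnertonDyer.BirchSwinnertonDyer.Theorems.PrintCf2RubinValueTwoKatzMeasureJZeroSeamIdentity
import Summits.BirchSwinnertonDyer.BirchSwinnertonDyer.Theorems.PrintCf2RubinValueTwoEllipticUnitsTwoVariableMeasureDischargedSteps
import Summits.BirchSwinnertonDyer.BirchSwinnertonDyer.Theorems.PrintCf2RubinValueTwoKatzMeasureJZeroIntegrandOfClassSums
import Literature.NumberTheory.EllipticCurves.DeShalit1987.AvatarArtinLift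
import Literature.NumberTheory.EllipticCurves.DeShalit1987.EisensteinClassSumRepsInvariance
import Literature.NumberTheory.EllipticCurves.PAdicOneVariableRayCharacterContinuous
import Literature.NumberTheory.NumberFields.RayClassFieldAdicTowerArtinClassesDegreeOne
import Literature.NumberTheory.LFunctions.RayClassRepsSumTransport
import Literature.NumberTheory.GaloisRepresentations.HeckeCharacterOfRayClassModulus
import HarnessLib

/-!
# The SEAM of the `j = 0` lane, PART 1a: the twisted class sum AT ONE CHAIN LEVEL from the per-unit VALUE identities (de Shalit II.4.14 (38)→(40), `j = 0`)

Cell `bsd-print-cf2`, width seat `bsd-line-cf2-p1-w8` g13; `--supports` the crux stmt-BirchSwinnertonDyer-20368 (helper, Theses-free).  THEOREMS ONLY; no `def`, no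
named fact, no `sorry`; CONDITIONAL on the prints `DeShalit1987.prop24_ii_galoisAction`, `prop24_iii_unit`, `prop25_i_normRelation`.  In D2's frame VERBATIM (the
∀-binders of -w3 g31's per-level statement `P1`), at a chain level `k` with `𝔣 k = 𝔪_M` and for ONE instance of hsum's data, `classSum_at_level_of_perUnitValues`
proves the RAW class-sum identity `∃ T, IsRayClassReps 𝔪_M T ∧ (lattice clauses) ∧ (N𝔠 − ι⁻¹(χ̃λ̃^m(𝔠)))·(Θ(ε_ϑ)·∫ ê dμ) = 12·(Θ(ε_ϑ)·A₁)^m·ι⁻¹(σ(β₁)^{−m}·χ̃λ̃^m((β₁)))·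
ι⁻¹((1 − ε(ϖ_v)⁻¹2⁻¹)·Σ_{𝔟∈T} χ̃(𝔟)⁻¹λ̃(𝔟)^{−m}(N𝔠·E_m(Ω, Lat 𝔟) − E_m(Ω, Lat(𝔠𝔟))))` from the seam identity `twist_mul_integral_eq_of_perUnit` (p764371) with every
generic hypothesis DISCHARGED (`hχG`/`hχc` bookkeeping file + `isModulus_const_succ_of_valueAtUniformizer_eq` (socket F2); `hne` A9 + `absNorm_sub_classCoeff_ne_zero`;
labels + `IsRayClassReps` H13 ∘ `of_mul_pow_of_padicIntEquiv_two`, translated by `(β₁)`; weights A9; Euler datum; `T ↦ 𝔭T` `sum_twist_eisensteinE_eq_sum_image_mul`;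
homogeneities by `β₁` (evaluation point `Ω₁ = σ(β₁)Ω` — the base-point move of the Q-θ conjugation; `β₁ = 1` allowed) and `α₀` (Frobenius point `σ(α₀)Ω₁`)).
NAMED, not discharged: the three prints, the lattice family `LM`/`Lat` (hsum's membership specs), and ★ the PER-UNIT VALUE IDENTITIES `hvals` ((γ)-FAM's output
shape, ONE value constant `A₁`, every family index, every moment).  Nothing here closes a crux; no summit statement is proved; BSD is not proved by any of this.
References: [deShalit1987] II.4.14 (36)–(40) (p. 71–73), II.4.7 (16)–(17), II.4.11, II.4.12 (31), II.4.17, II.3.3 (i); [NeukirchANT1999] Ch. VI §7 (7.1), Ch. VII §6 (6.8).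
-/


-- the summit namespace `Summit.BirchSwinnertonDyer.BirchSwinnertonDyer` repeats the problem name by design (D-0017)
set_option linter.dupNamespace false
set_option autoImplicit false

noncomputable section

open scoped Classical nonZeroDivisors NumberField
open NumberField Field IsDedekindDomain IsDedekindDomain.HeightOneSpectrum ValuativeRel IsLocalRing Literature.NumberTheory.NumberFields Literature.NumberTheory.PAdicHodge
open Literature.NumberTheory.GaloisRepresentations Literature.NumberTheory.GaloisRepresentations.IsNonarchimedeanLocalField Literature.NumberTheory.GaloisRepresentations.LubinTate
  Literature.NumberTheory.GaloisRepresentations.ArtinLocalGlobal Literature.NumberTheory.GaloisRepresentations.HeckeCharacter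
open Literature.NumberTheory.EllipticCurves Literature.NumberTheory.EllipticCurves.GroupDistribution Literature.NumberTheory.EllipticCurves.DeShalit1987
open Literature.NumberTheory.ComplexMultiplication.EllipticUnits Literature.NumberTheory.LFunctions
open Literature.NumberTheory.LFunctions.AbelianDensity (artinSymbol)
open Summit.BirchSwinnertonDyer.BirchSwinnertonDyer.Theorems.PrintCf2.EllipticUnitsLocal Summit.BirchSwinnertonDyer.BirchSwinnertonDyer.Theorems.PrintCf2.EllipticUnitsGlobal
  Summit.BirchSwinnertonDyer.BirchSwinnertonDyer.Theorems.PrintCf2.EllipticUnitsGlobalCompat Summit.BirchSwinnertonDyer.BirchSwinnertonDyer.Theorems.PrintCf2.EllipticUnitsTwoVariable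

namespace Summit.BirchSwinnertonDyer.BirchSwinnertonDyer.Theorems.PrintCf2.KatzMeasureJZeroSeam

attribute [local instance] GlobalNormCoherentUnits.instCommMonoid GlobalNormCoherentUnits.galAction RelNormCoherentUnits.instCommMonoid
attribute [local instance] ltNormUniformSpace ltNormIsUniformAddGroup rk1 nF nE fintypeResidueField

set_option maxHeartbeats 3200000 in
/-- ★★★ **THE TWISTED CLASS SUM AT THE CHAIN LEVEL `k` (`𝔣 k = 𝔪_M`), RAW FORM** — see the module docstring: for a system `T` of
representatives of the ray classes mod `𝔪_M` (the Artin labels of the level-`0` cells, translated by `(β₁)`),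
`(N𝔠 − ι⁻¹(χ̃(𝔠)λ̃(𝔠)^m))·(Θ(ε_ϑ)·∫ ê dμ) = 12·(Θ(ε_ϑ)·A₁)^m·ι⁻¹(σ(β₁)^{−m}·χ̃λ̃^m((β₁)))·ι⁻¹((1 − ε(ϖ_v)⁻¹2⁻¹)·Σ_{𝔟∈T} χ̃(𝔟)⁻¹λ̃(𝔟)^{−m}(N𝔠·E_m(Ω, Lat 𝔟) − E_m(Ω, Lat(𝔠𝔟))))`.
GIVEN II.2.4 (ii)/(iii), II.2.5 (i). [cite: deShalit1987, II.4.14 (36)–(40) (p. 71–73), II.4.7 (16)–(17) (p. 60), II.4.11 (p. 65), II.4.17 (p. 77–78), II.3.3 (i)] -/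
theorem classSum_at_level_of_perUnitValues
    -- the prints
    (h24ii : DeShalit1987.prop24_ii_galoisAction) (h24iii : DeShalit1987.prop24_iii_unit) (h25 : DeShalit1987.prop25_i_normRelation)
    -- the frame
    {K : Type} [Field K] [NumberField K] [IsTotallyComplex K] (hK : IsImaginaryQuadratic K) (ι : PadicAlgCl 2 ≃+* ℂ) (w₀ : InfinitePlace K) {v vbar : HeightOneSpectrum (𝓞 K)} (hv2 : ((2 : ℕ) : 𝓞 K) ∈ v.asIdeal) (hvbar2 : ((2 : ℕ) : 𝓞 K) ∈ vbar.asIdeal) (hne : vbar ≠ v)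
    (hι : ∀ (w : InfinitePlace K) (k : 𝓞 K), k ∈ v.asIdeal ↔ ‖ι.symm (w.embedding (k : K))‖ < 1) {α₀ : 𝓞 K} (hv0 : v.asIdeal = Ideal.span {α₀})
    -- the local datum
    (hq : residueFieldCard (v.adicCompletion K) = 2) (h2 : (valuation (v.adicCompletion K)).IsUniformizer ((((2 : ℕ) : 𝒪[v.adicCompletion K]) : v.adicCompletion K))) (u : 𝒪[v.adicCompletion K]ˣ)
    (hu : ((((u : 𝒪[v.adicCompletion K]) * ((2 : ℕ) : 𝒪[v.adicCompletion K]) : 𝒪[v.adicCompletion K]) : v.adicCompletion K)) = ((α₀ : K) : v.adicCompletion K)) {σ₀ : absoluteGaloisGroup (v.adicCompletion K)} (hσ₀ : IsAbsArithFrob σ₀) {ε : (maxUnramifiedCompletion (v.adicCompletion K))ˣ}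
    (hε : maxUnramifiedCompletion.galAut (v.adicCompletion K) σ₀ (ε : maxUnramifiedCompletion (v.adicCompletion K)) = algebraMap 𝒪[v.adicCompletion K] (maxUnramifiedCompletion (v.adicCompletion K)) (u : 𝒪[v.adicCompletion K]) * (ε : maxUnramifiedCompletion (v.adicCompletion K)))
    (θ : CompletedAlgClosure (v.adicCompletion K) →+* ℂ_[2]) (hθc : Continuous θ) (hθ1 : ∀ z : CBall (v.adicCompletion K), ‖θ (z : CompletedAlgClosure (v.adicCompletion K))‖ ≤ 1) (hθζ : ∀ ζ' : ℂ_[2], (∃ n : ℕ, ζ' ^ 2 ^ n = 1) →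
      ∃ ζ : CompletedAlgClosure (v.adicCompletion K), (∃ n : ℕ, ζ ^ 2 ^ n = 1) ∧ θ ζ = ζ') (e₂ : v.adicCompletionIntegers K ≃+* ℤ_[2]) (hΘe : ∀ a : 𝒪[v.adicCompletion K], (θ.comp ((CBall (v.adicCompletion K)).subtype.comp
        (algebraMap (UnrCoeff (v.adicCompletion K)) (CBall (v.adicCompletion K))))) (intToUnrCoeff (v.adicCompletion K) a) = padicIntCast ℂ_[2] (((e₂ : v.adicCompletionIntegers K →+* ℤ_[2]).comp (integerEquivAdicCompletionIntegers v).toRingHom) a))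
    -- the tame set and the chain
    {S : Finset (HeightOneSpectrum (𝓞 K))} (hvS : v ∉ S) (hvbarS : vbar ∉ S) (𝔣 : ℕ → Ideal (𝓞 K)) (𝔩 : ℕ → HeightOneSpectrum (𝓞 K)) (h𝔣succ : ∀ k, 𝔣 (k + 1) = 𝔣 k * (𝔩 k).asIdeal) (hdiv : ∀ k, (𝔩 k).asIdeal ∣ 𝔣 k) (hcof : ∀ m : ℕ, ∃ n, 𝔣 n ≤ ((∏ w ∈ S, w.asIdeal) * vbar.asIdeal) ^ m)
    -- D2's frame VERBATIM
    (h𝔣0 : ∀ m : ℕ, 𝔣 m ≠ ⊥) (h𝔣1 : ∀ m : ℕ, 𝔣 m ≠ ⊤) (hvm : ∀ m : ℕ, ¬ 𝔣 m ≤ v.asIdeal) (hwm : ∀ (m : ℕ) (u : (𝓞 K)ˣ), (u : 𝓞 K) - 1 ∈ 𝔣 m → u = 1) (hle : ∀ m : ℕ, 𝔣 (m + 1) ≤ 𝔣 m) (α : ℕ → 𝓞 K) (hα0 : ∀ m, α m ≠ 0) (hα𝔣 : ∀ m, α m - 1 ∈ 𝔣 m)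
    (hαw : ∀ (m : ℕ) (w : HeightOneSpectrum (𝓞 K)), w ≠ v → α m ∉ w.asIdeal) (f : ℕ → ℕ) (hαπ : ∀ m, ((α m : K) : v.adicCompletion K) = ((((u : 𝒪[v.adicCompletion K]) * ((2 : ℕ) : 𝒪[v.adicCompletion K]) : 𝒪[v.adicCompletion K]) : v.adicCompletion K)) ^ f m)
    (E : ℕ → IntermediateField (v.adicCompletion K) (AlgebraicClosure (v.adicCompletion K))) [hfd : ∀ m, FiniteDimensional (v.adicCompletion K) (E m)] [hgal : ∀ m, IsGalois (v.adicCompletion K) (E m)] (hE : ∀ m, E m ≤ maxUnramified (v.adicCompletion K))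
    (hdegE : ∀ (m : ℕ) (w : WeilGroup (v.adicCompletion K)), WeilGroup.toAbsGalois (v.adicCompletion K) w ∈ (E m).fixingSubgroup → (f m : ℤ) ∣ WeilGroup.deg w) (hEE : ∀ m, E m ≤ E (m + 1)) (j : ∀ m : ℕ, unitBall (E m) →+* UnrCoeff (v.adicCompletion K))
    (hj : ∀ m, (j m).comp (algebraMap (LTCoeff (v.adicCompletion K)) (unitBall (E m))) = (intToUnrCoeff (v.adicCompletion K)).comp (LTCoeff.of (v.adicCompletion K)).symm.toRingHom)
    (hjC : ∀ m, (algebraMap (UnrCoeff (v.adicCompletion K)) (CBall (v.adicCompletion K))).comp (j m) = unitBallToCBall (E m)) (hjj : ∀ (m : ℕ) (y : unitBall (E m)), j (m + 1) (inclUnitBall (F := v.adicCompletion K) (hEE m) y) = j m y)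
    (ψ : ∀ m n : ℕ, ↥(absRestrictNormalHom (rayClassField K (𝔣 m))).ker ⧸ (rayAdicTower (𝔪 := 𝔣 m) (h𝔣0 m) v).U n → ZMod (2 ^ (n + 1))) (hψ : ∀ (m n : ℕ) (g : ↥(absRestrictNormalHom (rayClassField K (𝔣 m))).ker), g ∈ (rayAdicTower (𝔪 := 𝔣 m) (h𝔣0 m) v).U 0 →
      ψ m n ((rayAdicTower (𝔪 := 𝔣 m) (h𝔣0 m) v).proj n g) = PadicInt.toZModPow (n + 1) ((((Units.map (e₂ : v.adicCompletionIntegers K →+* ℤ_[2]).toMonoidHom).comp (rayAdicCharacter (h𝔣0 m) (hvm m) (hwm m)))⁻¹ g : ℤ_[2]ˣ) : ℤ_[2]))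
    (g : {c : Ideal (𝓞 K) // c ≠ ⊥ ∧ IsCoprime c (𝔣 0 * v.asIdeal)} → absoluteGaloisGroup K) (hg : ∀ (c : {c : Ideal (𝓞 K) // c ≠ ⊥ ∧ IsCoprime c (𝔣 0 * v.asIdeal)}) (m k : ℕ), absRestrictNormalHom (rayClassField K (𝔣 m * v.asIdeal ^ (k + 1))) (g c) =
        artinSymbol (galFrob K (rayClassField K (𝔣 m * v.asIdeal ^ (k + 1)))) c.1) (x : ∀ (_ : {c : Ideal (𝓞 K) // c ≠ ⊥ ∧ IsCoprime c (𝔣 0 * v.asIdeal)}) (m k : ℕ), rayClassField K (𝔣 m * v.asIdeal ^ (k + 1))) (hx : ∀ (c : {c : Ideal (𝓞 K) // c ≠ ⊥ ∧ IsCoprime c (𝔣 0 * v.asIdeal)}) (m k : ℕ),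
      IsThetaValueOne w₀.embedding (𝔣 m * v.asIdeal ^ (k + 1)) c.1 (algClosureEmb w₀.embedding ((x c m k : rayClassField K (𝔣 m * v.asIdeal ^ (k + 1))) : AlgebraicClosure K))) [hN : ∀ m n, ((rayAdicTower (𝔪 := 𝔣 m) (h𝔣0 m) v).U n).Normal]
    [hNabs : ∀ m n, ((absRayAdicTower (𝔪' := 𝔣 m) (h𝔣0 m) v).U n).Normal] (μ : GroupDistribution (SubgroupTower.diagonal (fun m ↦ absRayAdicTower (𝔪' := 𝔣 m) (h𝔣0 m) v) (fun m n ↦ absRayAdicTower_U_anti (h𝔣0 m) (h𝔣0 (m + 1)) v (hle m) n)) ℂ_[2])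
    (hμ : ∀ (c : {c : Ideal (𝓞 K) // c ≠ ⊥ ∧ IsCoprime c (𝔣 0 * v.asIdeal)}) (n : ℕ) (b : absoluteGaloisGroup K ⧸ (absRayAdicTower (𝔪' := 𝔣 n) (h𝔣0 n) v).U n), (twisting (g c) (Ideal.absNorm c.1 : ℂ_[2]) μ).μ n b = (GroupDistribution.induceFrom (Γ := absoluteGaloisGroup K)
        (fun k ↦ rayAdicTower_U_eq_subgroupOf (𝔪 := 𝔣 n) (h𝔣0 n) v k) (fun b : GlobalNormCoherentUnits (h𝔣0 n) v ↦ localMeasureFamily (h𝔣0 n) (hvm n) (hwm n) hq h2 u (E n) (hE n) hσ₀ hε θ hθ1 (j n) (hjC n) e₂ (ψ n) (hψ n)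
            (RelNormCoherentUnits.ofGlobalUnits (h𝔣0 n) (hvm n) (hwm n) (isUniformizer_unit_mul h2 u) (hα0 n) (hα𝔣 n) (hαw n) (hαπ n) (E n) (hE n) (hdegE n) b)) zero_le_one (fun _ ↦ le_rfl)
        (ellipticUnitsGlobal h24iii h25 hK w₀.embedding (h𝔣0 n) (h𝔣1 n) (hvm n) (hwm n) c.2.1 (isCoprime_chain 𝔣 𝔩 h𝔣succ hdiv c.2.2 n) (x c n) (hx c n))).μ n b)
    -- the level and ONE instance of hsum's data
    (k M : ℕ) (hkM : 𝔣 k = modulusIdeal (insert vbar S) (fun _ ↦ M)) (lam : HeckeCharacter K) (hl : lam.HasInfinityType (fun _ ↦ 1) (fun _ ↦ 0)) (hlmod : lam.IsModulus (insert vbar S) (fun _ ↦ M)) (h𝔪1 : modulusIdeal (insert vbar S) (fun _ ↦ M) ≠ ⊤)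
    (hw : ∀ uu : (𝓞 K)ˣ, (uu : 𝓞 K) - 1 ∈ modulusIdeal (insert vbar S) (fun _ ↦ M) → uu = 1) (χ : HeightOneSpectrum (𝓞 K) → ℂ) (hχ : IsRayClassCharacter (modulusIdeal (insert vbar S) (fun _ ↦ M)) χ) (𝔠 : Ideal (𝓞 K)) (h𝔠0 : 𝔠 ≠ ⊥) (h𝔠cop : IsCoprime 𝔠 (modulusIdeal (insert vbar S) (fun _ ↦ M)))
    (h𝔠v : IsCoprime 𝔠 v.asIdeal) (εH : HeckeCharacter K) (eH : FramedGaloisRep K (PadicAlgCl 2) 1) (m : ℕ) (he : IsPAdicAvatarOutside S ι εH eH) (hm : 3 ≤ m) (hεt : εH.HasInfinityType (fun _ ↦ -(m : ℤ)) (fun _ ↦ 0)) (hεunr : ∀ w : HeightOneSpectrum (𝓞 K), w ∉ S → w ≠ vbar → εH.IsUnramifiedAt w)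
    (hεu : ∀ w : HeightOneSpectrum (𝓞 K), ¬ modulusIdeal (insert vbar S) (fun _ ↦ M) ≤ w.asIdeal → εH.valueAtUniformizer w = (χ w)⁻¹ * (lam.valueAtUniformizer w ^ m)⁻¹) (hL : LFunction.HasEntireContinuation (heckeLFunction εH))
    -- the value constant, the periods (lattice scale `Ω`, evaluation point `Ω₁ = σ(β₁)Ω`, Frobenius point `Ω₁′ = σ(α₀)Ω₁`), the lattices
    (A₁ : ℂ_[2]) (Ω : ℂ) (hΩ : Ω ≠ 0) {β₁ : 𝓞 K} (hβ₁ : IsCoprime (Ideal.span {β₁}) (modulusIdeal (insert vbar S) (fun _ ↦ M) * v.asIdeal)) (Ω₁ : ℂ) (hΩ₁ : Ω₁ = w₀.embedding ((β₁ : 𝓞 K) : K) * Ω) (Ω₁' : ℂ) (hΩ₁' : Ω₁' = w₀.embedding ((α₀ : 𝓞 K) : K) * Ω₁)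
    (LM : PeriodPair) (hLM : ∀ z : ℂ, z ∈ LM.lattice ↔ ∃ y ∈ ((modulusIdeal (insert vbar S) (fun _ ↦ M) : Ideal (𝓞 K)) : FractionalIdeal (𝓞 K)⁰ K), z = Ω * w₀.embedding y) (Lat : Ideal (𝓞 K) → PeriodPair) (hLat : ∀ 𝔟 : Ideal (𝓞 K), 𝔟 ≠ ⊥ → ∀ z : ℂ, z ∈ (Lat 𝔟).lattice ↔
      ∃ y ∈ ((modulusIdeal (insert vbar S) (fun _ ↦ M) : FractionalIdeal (𝓞 K)⁰ K) / (𝔟 : FractionalIdeal (𝓞 K)⁰ K)), z = Ω * w₀.embedding y)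
    -- ★ the per-unit VALUE identities ((γ)-FAM's output shape, ONE value constant `A₁`, every family index, every moment)
    (hvals : ∀ (i : {c : Ideal (𝓞 K) // c ≠ ⊥ ∧ IsCoprime c (𝔣 0 * v.asIdeal)}) (k' : ℕ), (θ.comp ((CBall (v.adicCompletion K)).subtype.comp (algebraMap (UnrCoeff (v.adicCompletion K)) (CBall (v.adicCompletion K))))) (j k (PowerSeries.constantCoeff ((fun g' : PowerSeries (unitBall (E k)) =>
          (invDiff (isLTRing_LTCoeff (isUniformizer_unit_mul h2 u)) (isLTSeries_LTCoeff ((u : 𝒪[v.adicCompletion K]) * ((2 : ℕ) : 𝒪[v.adicCompletion K])))).map (algebraMap (LTCoeff (v.adicCompletion K)) (unitBall (E k))) * PowerSeries.derivative (unitBall (E k)) g')^[k']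
          (relLogDerivSeries (isUniformizer_unit_mul h2 u) (E k) hq (hE k) hσ₀ (RelNormCoherentUnits.ofGlobalUnits (h𝔣0 k) (hvm k) (hwm k) (isUniformizer_unit_mul h2 u) (hα0 k) (hα𝔣 k) (hαw k) (hαπ k) (E k) (hE k) (hdegE k)
              (ellipticUnitsGlobal h24iii h25 hK w₀.embedding (h𝔣0 k) (h𝔣1 k) (hvm k) (hwm k) i.2.1 (isCoprime_chain 𝔣 𝔩 h𝔣succ hdiv i.2.2 k) (x i k) (hx i k))))))) = A₁ ^ (k' + 1) * ((ι.symm (-12 * (((Ideal.absNorm i.1 : ℕ) : ℂ) * LM.eisensteinE (k' + 1) Ω₁ - (Lat i.1).eisensteinE (k' + 1) Ω₁)) :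
            PadicAlgCl 2) : ℂ_[2]) ∧ (θ.comp ((CBall (v.adicCompletion K)).subtype.comp (algebraMap (UnrCoeff (v.adicCompletion K)) (CBall (v.adicCompletion K))))) (j k ((frobUnitBall (E k) σ₀ : unitBall (E k) →+* unitBall (E k)) (PowerSeries.constantCoeff ((fun g' : PowerSeries (unitBall (E k)) =>
          (invDiff (isLTRing_LTCoeff (isUniformizer_unit_mul h2 u)) (isLTSeries_LTCoeff ((u : 𝒪[v.adicCompletion K]) * ((2 : ℕ) : 𝒪[v.adicCompletion K])))).map (algebraMap (LTCoeff (v.adicCompletion K)) (unitBall (E k))) * PowerSeries.derivative (unitBall (E k)) g')^[k']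
          (relLogDerivSeries (isUniformizer_unit_mul h2 u) (E k) hq (hE k) hσ₀ (RelNormCoherentUnits.ofGlobalUnits (h𝔣0 k) (hvm k) (hwm k) (isUniformizer_unit_mul h2 u) (hα0 k) (hα𝔣 k) (hαw k) (hαπ k) (E k) (hE k) (hdegE k)
              (ellipticUnitsGlobal h24iii h25 hK w₀.embedding (h𝔣0 k) (h𝔣1 k) (hvm k) (hwm k) i.2.1 (isCoprime_chain 𝔣 𝔩 h𝔣succ hdiv i.2.2 k) (x i k) (hx i k)))))))) = A₁ ^ (k' + 1) *
          ((ι.symm (-12 * (((Ideal.absNorm i.1 : ℕ) : ℂ) * LM.eisensteinE (k' + 1) Ω₁' - (Lat i.1).eisensteinE (k' + 1) Ω₁')) : PadicAlgCl 2) : ℂ_[2])) : ∃ T : Finset (Ideal (𝓞 K)), IsRayClassReps (modulusIdeal (insert vbar S) (fun _ ↦ M)) T ∧ (∀ 𝔟 ∈ T, ∀ z : ℂ, z ∈ (Lat 𝔟).lattice ↔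
        ∃ y ∈ ((modulusIdeal (insert vbar S) (fun _ ↦ M) : FractionalIdeal (𝓞 K)⁰ K) / (𝔟 : FractionalIdeal (𝓞 K)⁰ K)), z = Ω * w₀.embedding y) ∧ (∀ 𝔟 ∈ T, ∀ z : ℂ, z ∈ (Lat (𝔠 * 𝔟)).lattice ↔ ∃ y ∈ ((modulusIdeal (insert vbar S) (fun _ ↦ M) : FractionalIdeal (𝓞 K)⁰ K) /
          ((𝔠 * 𝔟 : Ideal (𝓞 K)) : FractionalIdeal (𝓞 K)⁰ K)), z = Ω * w₀.embedding y) ∧ ((Ideal.absNorm 𝔠 : ℂ_[2]) - ((ι.symm (idealPow K χ 𝔠 * idealPow K (fun w ↦ lam.valueAtUniformizer w) 𝔠 ^ m) : PadicAlgCl 2) : ℂ_[2])) * ((θ.comp ((CBall (v.adicCompletion K)).subtype.comp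
            (algebraMap (UnrCoeff (v.adicCompletion K)) (CBall (v.adicCompletion K))))) (PowerSeries.coeff 1 (compSeriesC h2 hσ₀ u hε)) * μ.integral (fun σ ↦ avatarValueAt eH σ)) = 12 * ((θ.comp ((CBall (v.adicCompletion K)).subtype.comp
              (algebraMap (UnrCoeff (v.adicCompletion K)) (CBall (v.adicCompletion K))))) (PowerSeries.coeff 1 (compSeriesC h2 hσ₀ u hε)) * A₁) ^ m * ((ι.symm (((w₀.embedding ((β₁ : 𝓞 K) : K)) ^ m)⁻¹ *
            (idealPow K χ (Ideal.span {β₁}) * idealPow K (fun w ↦ lam.valueAtUniformizer w) (Ideal.span {β₁}) ^ m)) : PadicAlgCl 2) : ℂ_[2]) * ((ι.symm ((1 - (εH.valueAtUniformizer v)⁻¹ * (((2 : ℕ) : ℂ))⁻¹) * ∑ 𝔟 ∈ T, (idealPow K χ 𝔟)⁻¹ * (idealPow K (fun w ↦ lam.valueAtUniformizer w) 𝔟 ^ m)⁻¹ *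
              ((Ideal.absNorm 𝔠 : ℂ) * (Lat 𝔟).eisensteinE m Ω - (Lat (𝔠 * 𝔟)).eisensteinE m Ω)) : PadicAlgCl 2) : ℂ_[2]) := by
  classical
  set Θ : UnrCoeff (v.adicCompletion K) →+* ℂ_[2] := θ.comp ((CBall (v.adicCompletion K)).subtype.comp
    (algebraMap (UnrCoeff (v.adicCompletion K)) (CBall (v.adicCompletion K)))) with hΘdef
  set τC : ℂ →+* ℂ_[2] := (algebraMap (PadicAlgCl 2) ℂ_[2]).comp ι.symm.toRingHom with hτC
  have hτapp : ∀ z : ℂ, ((ι.symm z : PadicAlgCl 2) : ℂ_[2]) = τC z := fun z ↦ rfl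
  have h𝔪0 : modulusIdeal (insert vbar S) (fun _ ↦ M) ≠ ⊥ := modulusIdeal_ne_bot _ _
  haveI : v.asIdeal.LiesOver (ratPlace 2).asIdeal := liesOver_ratPlace_of_natCast_mem K v hv2
  obtain ⟨he1, hf1⟩ := ramificationIdx_eq_one_and_inertiaDeg_eq_one_of_natCast_mem_of_ne K hK.1 hv2 hvbar2 hne
  have htwo := eq_or_eq_of_natCast_two_mem hK.1 hv2 hvbar2 hne
  have hvT : v ∉ insert vbar S := by
    rw [Finset.mem_insert, not_or]; exact ⟨hne.symm, hvS⟩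
  have hvbarT : vbar ∈ insert vbar S := Finset.mem_insert_self _ _
  have h𝔪v : ¬ modulusIdeal (insert vbar S) (fun _ ↦ M) ≤ v.asIdeal := by rw [modulusIdeal_le_iff]; exact hvT
  have hIcop : ∀ i : {c : Ideal (𝓞 K) // c ≠ ⊥ ∧ IsCoprime c (𝔣 0 * v.asIdeal)}, IsCoprime i.1 (modulusIdeal (insert vbar S) (fun _ ↦ M)) := fun i ↦ by
    rw [← hkM]; exact (isCoprime_chain 𝔣 𝔩 h𝔣succ hdiv i.2.2 k).of_mul_right_left
  have hIv : ∀ i : {c : Ideal (𝓞 K) // c ≠ ⊥ ∧ IsCoprime c (𝔣 0 * v.asIdeal)}, IsCoprime i.1 v.asIdeal := fun i ↦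
    i.2.2.of_mul_right_right
  have hIS : ∀ (i : {c : Ideal (𝓞 K) // c ≠ ⊥ ∧ IsCoprime c (𝔣 0 * v.asIdeal)}) (w : HeightOneSpectrum (𝓞 K)), i.1 ≤ w.asIdeal → w ∉ S ∧ ((2 : ℕ) : 𝓞 K) ∉ w.asIdeal := by
    intro i w hiw
    have hw𝔪 : ¬ modulusIdeal (insert vbar S) (fun _ ↦ M) ≤ w.asIdeal := fun h ↦ (isCoprime_iff_forall_not_le h𝔪0).mp (hIcop i) w h hiw
    have hwv : ¬ v.asIdeal ≤ w.asIdeal := fun h ↦ (isCoprime_iff_forall_not_le v.ne_bot).mp (hIv i) w h hiw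
    have hwT : w ∉ insert vbar S := by rwa [modulusIdeal_le_iff] at hw𝔪
    rw [Finset.mem_insert, not_or] at hwT
    refine ⟨hwT.2, fun hw2 ↦ ?_⟩
    rcases htwo w hw2 with rfl | rfl
    · exact hwv le_rfl
    · exact hwT.1 rfl
  have hIF : ∀ (i : {c : Ideal (𝓞 K) // c ≠ ⊥ ∧ IsCoprime c (𝔣 0 * v.asIdeal)}) (p : ℕ × ℕ), IsCoprime i.1 (𝔣 p.1 * v.asIdeal ^ (p.2 + 1)) := fun i p ↦
    isCoprime_mul_pow_succ (isCoprime_chain 𝔣 𝔩 h𝔣succ hdiv i.2.2 p.1) p.2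
  have hle0 : ∀ n : ℕ, 𝔣 n ≤ 𝔣 0 := fun n ↦ by
    induction n with
    | zero => exact le_rfl
    | succ n ih => exact (hle n).trans ih
  have h𝔠c0 : IsCoprime 𝔠 (𝔣 0 * v.asIdeal) := by
    refine IsCoprime.mul_right ?_ h𝔠v
    have h' : IsCoprime 𝔠 (𝔣 k) := by rw [hkM]; exact h𝔠cop
    exact h'.of_isCoprime_of_dvd_right (Ideal.dvd_iff_le.mpr (hle0 k))
  set cI : {c : Ideal (𝓞 K) // c ≠ ⊥ ∧ IsCoprime c (𝔣 0 * v.asIdeal)} := ⟨𝔠, h𝔠0, h𝔠c0⟩ with hcIdef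
  have hχmul : ∀ y z, avatarValueAt eH (y * z) = avatarValueAt eH y * avatarValueAt eH z := avatarValueAt_mul eH
  have h1 : avatarValueAt eH 1 = 1 := avatarValueAt_one eH
  have hεmod : εH.IsModulus (insert vbar S) (fun _ ↦ M + 1) := isModulus_const_succ_of_valueAtUniformizer_eq hχ hlmod hεu
  have hleM : ∀ w ∈ insert vbar S, ((fun _ ↦ M + 1 : HeightOneSpectrum (𝓞 K) → ℕ) w : ℤ) ≤
      FractionalIdeal.count K w ((𝔣 k : Ideal (𝓞 K)) : FractionalIdeal (𝓞 K)⁰ K) := fun w hw' ↦ by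
    rw [hkM]; exact natCast_const_succ_le_count_modulusIdeal (insert vbar S) M w hw'
  have hχG : ∀ y : ↥(absRestrictNormalHom (rayClassField K (𝔣 k))).ker, avatarValueAt eH y = padicIntCast ℂ_[2] (((((Units.map (e₂ : v.adicCompletionIntegers K →+* ℤ_[2]).toMonoidHom).comp
        (rayAdicCharacter (h𝔣0 k) (hvm k) (hwm k)))⁻¹) y : ℤ_[2]) ^ (m - 1 + 1)) := fun y ↦ by
    rw [Nat.sub_add_cancel (by omega : 1 ≤ m)]
    exact avatarValueAt_ker_eq_padicIntCast_inv_pow hK.1 ι w₀ hv2 hvbar2 hne (hι w₀) (h𝔣0 k) (hvm k) (hwm k) e₂ he hεt hεmod hleM y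
  have hχc : (absRayAdicTower (𝔪' := 𝔣 k) (h𝔣0 k) v).IsTowerContinuous (fun σ ↦ avatarValueAt eH σ) :=
    isTowerContinuous_absRayAdicTower_of_restrict_eq_character_pow (h𝔣0 k) (hvm k) (hwm k) e₂ hχmul (m - 1 + 1) hχG
  have hunr' : ∀ w : HeightOneSpectrum (𝓞 K), w ∉ S → ((2 : ℕ) : 𝓞 K) ∉ w.asIdeal → εH.IsUnramifiedAt w :=
    fun w hwS hw2 ↦ hεunr w hwS (fun h ↦ hw2 (h ▸ hvbar2))
  have hF0 : ∀ p : ℕ × ℕ, 𝔣 p.1 * v.asIdeal ^ (p.2 + 1) ≠ ⊥ := fun p ↦ mul_ne_zero (h𝔣0 p.1) (pow_ne_zero _ v.ne_bot)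
  have hray : ∀ σ : absoluteGaloisGroup K, (∀ p : ℕ × ℕ, absRestrictNormalHom (rayClassField K (𝔣 p.1 * v.asIdeal ^ (p.2 + 1))) σ = 1) → σ ∈ DeShalit1987.rayKer K 2 S := by
    intro σ hσ
    have hsub := DeShalit1987.iInter_diagonal_absRayAdicTower_subset_rayKer_of_finrank_eq_two 2 S h𝔣0
      (fun m n ↦ absRayAdicTower_U_anti (h𝔣0 m) (h𝔣0 (m + 1)) v (hle m) n) hK.1 hv2 hvbar2 hne hle hcof
    refine hsub (Set.mem_iInter.mpr fun n ↦ ?_)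
    rw [SetLike.mem_coe, SubgroupTower.diagonal_U, mem_absRayAdicTower_U_iff, MonoidHom.mem_ker]
    exact hσ (n, n)
  have hA9 : ∀ i : {c : Ideal (𝓞 K) // c ≠ ⊥ ∧ IsCoprime c (𝔣 0 * v.asIdeal)}, avatarValueAt eH (g i) = ((ι.symm (idealPow K χ i.1 * idealPow K (fun w ↦ lam.valueAtUniformizer w) i.1 ^ m) : PadicAlgCl 2) : ℂ_[2]) :=
    fun i ↦ he.avatarValueAt_eq_idealPow_mul_pow_of_forall_absRestrictNormalHom_eq_artinSymbol hunr'
      (F := fun p : ℕ × ℕ ↦ 𝔣 p.1 * v.asIdeal ^ (p.2 + 1)) hF0 hray i.2.1 (hIS i) (hIF i) (fun p ↦ hg i p.1 p.2) h𝔪0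
      (hIcop i) hεu
  have hA9inv : ∀ i : {c : Ideal (𝓞 K) // c ≠ ⊥ ∧ IsCoprime c (𝔣 0 * v.asIdeal)}, avatarValueAt eH (g i)⁻¹ = ((ι.symm ((idealPow K χ i.1)⁻¹ * (idealPow K (fun w ↦ lam.valueAtUniformizer w) i.1 ^ m)⁻¹) : PadicAlgCl 2) : ℂ_[2]) :=
    fun i ↦ he.avatarValueAt_inv_eq_idealPow_inv_mul_pow_inv_of_forall_absRestrictNormalHom_eq_artinSymbol hunr'
      (F := fun p : ℕ × ℕ ↦ 𝔣 p.1 * v.asIdeal ^ (p.2 + 1)) hF0 hray i.2.1 (hIS i) (hIF i) (fun p ↦ hg i p.1 p.2) h𝔪0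
      (hIcop i) hεu
  have hA : ∀ c' : absoluteGaloisGroup K ⧸ (absRayAdicTower (𝔪' := 𝔣 k) (h𝔣0 k) v).U 0, ∃ i : {c : Ideal (𝓞 K) // c ≠ ⊥ ∧ IsCoprime c (𝔣 0 * v.asIdeal)}, (absRayAdicTower (𝔪' := 𝔣 k) (h𝔣0 k) v).proj 0 (g i) = c'⁻¹ := fun c' ↦ by
    obtain ⟨𝔞, h0, hc, h⟩ := exists_ideal_forall_proj_zero_eq (h𝔣0 k) v c'⁻¹
    have hc' : IsCoprime 𝔞 (𝔣 k * v.asIdeal) := by simpa only [zero_add, pow_one] using hc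
    let i : {c : Ideal (𝓞 K) // c ≠ ⊥ ∧ IsCoprime c (𝔣 0 * v.asIdeal)} := ⟨𝔞, h0, hc'.of_isCoprime_of_dvd_right (mul_dvd_mul_right (Ideal.dvd_iff_le.mpr (hle0 k)) _)⟩
    exact ⟨i, h (g i) (by rw [hg i k 0])⟩
  choose aL haL using hA
  obtain ⟨bL, hbL⟩ : ∃ bL : absoluteGaloisGroup K ⧸ (absRayAdicTower (𝔪' := 𝔣 k) (h𝔣0 k) v).U 0 → {c : Ideal (𝓞 K) // c ≠ ⊥ ∧ IsCoprime c (𝔣 0 * v.asIdeal)}, ∀ c', (bL c').1 = (aL c').1 * cI.1 :=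
    ⟨fun c' ↦ ⟨(aL c').1 * 𝔠, mul_ne_zero (aL c').2.1 h𝔠0, (aL c').2.2.mul_left h𝔠c0⟩, fun _ ↦ rfl⟩
  have hac : ∀ c', IsCoprime ((Subtype.val ∘ aL) c') (𝔣 k * v.asIdeal ^ ((0 : ℕ) + 1)) := fun c' ↦
    isCoprime_mul_pow_succ (isCoprime_chain 𝔣 𝔩 h𝔣succ hdiv (aL c').2.2 k) 0
  have hbij : Function.Bijective fun c' ↦ (absRayAdicTower (𝔪' := 𝔣 k) (h𝔣0 k) v).proj 0 ((g ∘ aL) c') := by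
    simp only [Function.comp_apply, haL]
    exact inv_involutive.bijective
  have hinj : Set.InjOn (fun c' ↦ (aL c').1) ((absRayAdicTower (𝔪' := 𝔣 k) (h𝔣0 k) v).cells 0) :=
    fun c₁ _ c₂ _ h ↦ eq_of_artin_labels_eq (h𝔣0 k) v (Subtype.val ∘ aL) (fun c' ↦ (aL c').2.1) hac (g ∘ aL)
      (fun c' ↦ hg (aL c') k 0) hbij h
  set T₀ : Finset (Ideal (𝓞 K)) := ((absRayAdicTower (𝔪' := 𝔣 k) (h𝔣0 k) v).cells 0).image (fun c' ↦ (aL c').1) with hT₀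
  have hT₀reps : IsRayClassReps (modulusIdeal (insert vbar S) (fun _ ↦ M)) T₀ := by
    rw [← hkM]
    exact Literature.NumberTheory.NumberFields.IsRayClassReps.of_mul_pow_of_padicIntEquiv_two (h𝔣0 k) (hvm k) (hwm k) e₂
      (isRayClassReps_image_of_artin_labels (h𝔣0 k) v (Subtype.val ∘ aL) (fun c' ↦ (aL c').2.1) hac (g ∘ aL) (fun c' ↦ hg (aL c') k 0) hbij)
  have hβ₁0 : β₁ ≠ 0 := by
    rintro rfl
    rw [Ideal.span_singleton_zero, ← Ideal.zero_eq_bot, isCoprime_zero_left, Ideal.isUnit_iff] at hβ₁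
    exact v.isPrime.ne_top (top_le_iff.mp (hβ₁ ▸ Ideal.mul_le_left))
  have h𝔟₁0 : Ideal.span {β₁} ≠ ⊥ := fun h ↦ hβ₁0 (Ideal.span_singleton_eq_bot.mp h)
  have h𝔟₁cop : IsCoprime (Ideal.span {β₁}) (modulusIdeal (insert vbar S) (fun _ ↦ M)) := hβ₁.of_mul_right_left
  have h𝔟₁v : IsCoprime (Ideal.span {β₁}) v.asIdeal := hβ₁.of_mul_right_right
  set T : Finset (Ideal (𝓞 K)) := T₀.image (Ideal.span {β₁} * ·) with hTdef
  have hTreps : IsRayClassReps (modulusIdeal (insert vbar S) (fun _ ↦ M)) T := hT₀reps.image_mul h𝔪0 h𝔟₁0 h𝔟₁cop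
  obtain ⟨𝒲, h𝒲def⟩ : ∃ 𝒲 : Ideal (𝓞 K) → ℂ, ∀ 𝔟, 𝒲 𝔟 = (idealPow K χ 𝔟)⁻¹ * (idealPow K (fun w ↦ lam.valueAtUniformizer w) 𝔟 ^ m)⁻¹ :=
    ⟨fun 𝔟 ↦ _, fun _ ↦ rfl⟩
  have h𝒲mul : ∀ 𝔞 𝔟 : Ideal (𝓞 K), 𝔞 ≠ ⊥ → 𝔟 ≠ ⊥ → 𝒲 (𝔞 * 𝔟) = 𝒲 𝔞 * 𝒲 𝔟 := by
    intro 𝔞 𝔟 h𝔞 h𝔟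
    rw [h𝒲def, h𝒲def, h𝒲def, idealPow_mul _ h𝔞 h𝔟, idealPow_mul _ h𝔞 h𝔟, mul_pow, mul_inv, mul_inv]
    ring
  have hχv0 : χ v ≠ 0 := hχ.ne_zero h𝔪v
  have hlamv0 : lam.valueAtUniformizer v ≠ 0 := lam.valueAtUniformizer_ne_zero' v
  set w𝔭 : ℂ := χ v * lam.valueAtUniformizer v ^ m with hw𝔭def
  have hw𝔭0 : w𝔭 ≠ 0 := mul_ne_zero hχv0 (pow_ne_zero _ hlamv0)
  have h𝒲v : 𝒲 v.asIdeal = w𝔭⁻¹ := by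
    rw [h𝒲def, hw𝔭def, idealPow_asIdeal, idealPow_asIdeal, mul_inv]
  have h𝒲 : ∀ 𝔟 ∈ T₀, 𝒲 𝔟 = 𝒲 (v.asIdeal * 𝔟) * w𝔭 := by
    intro 𝔟 h𝔟
    rw [h𝒲mul _ _ v.ne_bot (hT₀reps.ne_bot_and_isCoprime 𝔟 h𝔟).1, h𝒲v, mul_comm (w𝔭⁻¹), mul_assoc, inv_mul_cancel₀ hw𝔭0, mul_one]
  have hχg : ∀ c' ∈ (absRayAdicTower (𝔪' := 𝔣 k) (h𝔣0 k) v).cells 0, avatarValueAt eH (g (aL c'))⁻¹ = ((ι.symm (𝒲 (aL c').1) : PadicAlgCl 2) : ℂ_[2]) := fun c' _ ↦ by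
    rw [h𝒲def]; exact hA9inv (aL c')
  have hεv : εH.valueAtUniformizer v = w𝔭⁻¹ := by rw [hεu v h𝔪v, hw𝔭def, mul_inv]
  have hα₀0 : α₀ ≠ 0 := by
    rintro rfl
    exact v.ne_bot (by rw [hv0, Ideal.span_singleton_eq_bot])
  set cβ : ℂ := w₀.embedding ((β₁ : 𝓞 K) : K) with hcβdef
  set cα : ℂ := w₀.embedding ((α₀ : 𝓞 K) : K) with hcαdef
  have hcβ0 : cβ ≠ 0 := (map_ne_zero _).mpr (by exact_mod_cast hβ₁0)
  have hcα0 : cα ≠ 0 := (map_ne_zero _).mpr (by exact_mod_cast hα₀0)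
  have hspan0 : ∀ d : 𝓞 K, d ≠ 0 → Ideal.span {d} ≠ ⊥ := fun d hd h ↦ hd (Ideal.span_singleton_eq_bot.mp h)
  have hLatdiv : ∀ (𝔞 : Ideal (𝓞 K)) (d : 𝓞 K), 𝔞 ≠ ⊥ → d ≠ 0 → ∀ z : ℂ, z ∈ (Lat (Ideal.span {d} * 𝔞)).lattice ↔ ∃ y ∈ ((modulusIdeal (insert vbar S) (fun _ ↦ M) : Ideal (𝓞 K)) : FractionalIdeal (𝓞 K)⁰ K) /
        (𝔞 : FractionalIdeal (𝓞 K)⁰ K) / ((Ideal.span {d} : Ideal (𝓞 K)) : FractionalIdeal (𝓞 K)⁰ K), z = Ω * w₀.embedding y := by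
    intro 𝔞 d h𝔞 hd z
    have h0 : Ideal.span {d} * 𝔞 ≠ ⊥ := mul_ne_zero (hspan0 d hd) h𝔞
    rw [hLat _ h0, FractionalIdeal.coeIdeal_mul, mul_comm, div_mul_eq_div_div]
  have hLMdiv : ∀ (d : 𝓞 K), d ≠ 0 → ∀ z : ℂ, z ∈ (Lat (Ideal.span {d})).lattice ↔ ∃ y ∈ ((modulusIdeal (insert vbar S) (fun _ ↦ M) : Ideal (𝓞 K)) : FractionalIdeal (𝓞 K)⁰ K) /
        ((Ideal.span {d} : Ideal (𝓞 K)) : FractionalIdeal (𝓞 K)⁰ K), z = Ω * w₀.embedding y := fun d hd z ↦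
    hLat _ (hspan0 d hd) z
  have hhomβ : ∀ (𝔞 : Ideal (𝓞 K)), 𝔞 ≠ ⊥ → ∀ (n : ℕ) (z : ℂ), (Lat 𝔞).eisensteinE n (cβ * z) = (cβ ^ n)⁻¹ * (Lat (Ideal.span {β₁} * 𝔞)).eisensteinE n z := fun 𝔞 h𝔞 n z ↦
    eisensteinE_mul_eq_of_lattice_specs w₀.embedding _ hβ₁0 (hLat 𝔞 h𝔞) (hLatdiv 𝔞 β₁ h𝔞 hβ₁0) n z
  have hhomβM : ∀ (n : ℕ) (z : ℂ), LM.eisensteinE n (cβ * z) = (cβ ^ n)⁻¹ * (Lat (Ideal.span {β₁})).eisensteinE n z :=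
    fun n z ↦ eisensteinE_mul_eq_of_lattice_specs w₀.embedding _ hβ₁0 hLM (hLMdiv β₁ hβ₁0) n z
  have hhomα : ∀ (𝔞 : Ideal (𝓞 K)), 𝔞 ≠ ⊥ → ∀ (n : ℕ) (z : ℂ), (Lat 𝔞).eisensteinE n (cα * z) = (cα ^ n)⁻¹ * (Lat (v.asIdeal * 𝔞)).eisensteinE n z := fun 𝔞 h𝔞 n z ↦ by
    rw [hv0]; exact eisensteinE_mul_eq_of_lattice_specs w₀.embedding _ hα₀0 (hLat 𝔞 h𝔞) (hLatdiv 𝔞 α₀ h𝔞 hα₀0) n z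
  -- the values read at the lattice scale: `E₀ := E_m(Ω; Lat (β₁))`, `Ev 𝔞 := E_m(Ω; Lat((β₁)𝔞))`
  obtain ⟨Ev, hEvdef⟩ : ∃ Ev : Ideal (𝓞 K) → ℂ, ∀ 𝔞, Ev 𝔞 = (Lat (Ideal.span {β₁} * 𝔞)).eisensteinE m Ω :=
    ⟨fun 𝔞 ↦ _, fun _ ↦ rfl⟩
  set E₀ : ℂ := (Lat (Ideal.span {β₁})).eisensteinE m Ω with hE₀def
  set A : ℂ_[2] := A₁ ^ m * ((ι.symm ((cβ ^ m)⁻¹) : PadicAlgCl 2) : ℂ_[2]) with hAdef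
  set ψhat : ℂ := (cα ^ m)⁻¹ with hψhatdef
  have hm1 : m - 1 + 1 = m := Nat.sub_add_cancel (by omega : 1 ≤ m)
  have hXone : ∀ i : {c : Ideal (𝓞 K) // c ≠ ⊥ ∧ IsCoprime c (𝔣 0 * v.asIdeal)}, -12 * (((Ideal.absNorm i.1 : ℕ) : ℂ) * LM.eisensteinE m Ω₁ - (Lat i.1).eisensteinE m Ω₁) = (cβ ^ m)⁻¹ * (-12 * (((Ideal.absNorm i.1 : ℕ) : ℂ) * E₀ - Ev i.1)) := fun i ↦ by
    rw [hΩ₁, hhomβM, hhomβ i.1 i.2.1, hEvdef]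
    ring
  have hΦone : ∀ i : {c : Ideal (𝓞 K) // c ≠ ⊥ ∧ IsCoprime c (𝔣 0 * v.asIdeal)}, -12 * (((Ideal.absNorm i.1 : ℕ) : ℂ) * LM.eisensteinE m Ω₁' - (Lat i.1).eisensteinE m Ω₁') =
        (cβ ^ m)⁻¹ * (-12 * (ψhat * (((Ideal.absNorm i.1 : ℕ) : ℂ) * Ev v.asIdeal - Ev (v.asIdeal * i.1)))) := fun i ↦ by
    have hβv : Ideal.span {β₁} * (v.asIdeal * i.1) = v.asIdeal * (Ideal.span {β₁} * i.1) := by ring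
    rw [hΩ₁', hΩ₁, show cα * (cβ * Ω) = cβ * (cα * Ω) by ring, hhomβM, hhomβ i.1 i.2.1, hhomα _ h𝔟₁0, hhomα _ (mul_ne_zero h𝔟₁0 i.2.1), hEvdef, hEvdef, hβv, mul_comm v.asIdeal (Ideal.span {β₁}), hψhatdef]
    ring
  -- the relative Coates–Wiles values of the family units at level `k`, moment `m − 1`
  obtain ⟨cw, hcw⟩ : ∃ cw : {c : Ideal (𝓞 K) // c ≠ ⊥ ∧ IsCoprime c (𝔣 0 * v.asIdeal)} → unitBall (E k), ∀ i, cw i = PowerSeries.constantCoeff ((fun g' : PowerSeries (unitBall (E k)) => (invDiff (isLTRing_LTCoeff (isUniformizer_unit_mul h2 u))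
            (isLTSeries_LTCoeff ((u : 𝒪[v.adicCompletion K]) * ((2 : ℕ) : 𝒪[v.adicCompletion K])))).map
            (algebraMap (LTCoeff (v.adicCompletion K)) (unitBall (E k))) *
          PowerSeries.derivative (unitBall (E k)) g')^[m - 1]
        (relLogDerivSeries (isUniformizer_unit_mul h2 u) (E k) hq (hE k) hσ₀ (RelNormCoherentUnits.ofGlobalUnits (h𝔣0 k) (hvm k) (hwm k) (isUniformizer_unit_mul h2 u) (hα0 k) (hα𝔣 k) (hαw k) (hαπ k) (E k) (hE k) (hdegE k)
            (ellipticUnitsGlobal h24iii h25 hK w₀.embedding (h𝔣0 k) (h𝔣1 k) (hvm k) (hwm k) i.2.1 (isCoprime_chain 𝔣 𝔩 h𝔣succ hdiv i.2.2 k) (x i k) (hx i k))))) := ⟨fun i ↦ _, fun _ ↦ rfl⟩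
  have hX : ∀ c' ∈ (absRayAdicTower (𝔪' := 𝔣 k) (h𝔣0 k) v).cells 0, Θ (j k (cw (aL c'))) = A * ((ι.symm (-12 * ((Ideal.absNorm (aL c').1 : ℂ) * E₀ - Ev (aL c').1)) : PadicAlgCl 2) : ℂ_[2]) ∧
      Θ (j k (cw (bL c'))) = A * ((ι.symm (-12 * ((Ideal.absNorm (bL c').1 : ℂ) * E₀ - Ev (bL c').1)) : PadicAlgCl 2) : ℂ_[2]) := by
    intro c' _
    refine ⟨?_, ?_⟩
    · have h := (hvals (aL c') (m - 1)).1
      rw [hm1] at h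
      rw [hcw, h, hXone, map_mul, UniformSpace.Completion.coe_mul, hAdef]
      ring
    · have h := (hvals (bL c') (m - 1)).1
      rw [hm1] at h
      rw [hcw, h, hXone, map_mul, UniformSpace.Completion.coe_mul, hAdef]
      ring
  have hΦ : ∀ c' ∈ (absRayAdicTower (𝔪' := 𝔣 k) (h𝔣0 k) v).cells 0, Θ (j k ((frobUnitBall (E k) σ₀ : unitBall (E k) →+* unitBall (E k)) (cw (aL c')))) = A * ((ι.symm (-12 * (ψhat * ((Ideal.absNorm (aL c').1 : ℂ) * Ev v.asIdeal - Ev (v.asIdeal * (aL c').1)))) :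
          PadicAlgCl 2) : ℂ_[2]) ∧
      Θ (j k ((frobUnitBall (E k) σ₀ : unitBall (E k) →+* unitBall (E k)) (cw (bL c')))) = A * ((ι.symm (-12 * (ψhat * ((Ideal.absNorm (bL c').1 : ℂ) * Ev v.asIdeal - Ev (v.asIdeal * (bL c').1)))) : PadicAlgCl 2) : ℂ_[2]) := by
    intro c' _
    refine ⟨?_, ?_⟩
    · have h := (hvals (aL c') (m - 1)).2
      rw [hm1] at h
      rw [hcw, h, hΦone, map_mul, UniformSpace.Completion.coe_mul, hAdef]
      ring
    · have h := (hvals (bL c') (m - 1)).2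
      rw [hm1] at h
      rw [hcw, h, hΦone, map_mul, UniformSpace.Completion.coe_mul, hAdef]
      ring
  /- §6. The Euler datum `hW` (bookkeeping file). -/
  have hju : ∀ z : 𝒪[v.adicCompletion K], j k (algebraMap (LTCoeff (v.adicCompletion K)) (unitBall (E k)) (LTCoeff.of (v.adicCompletion K) z)) = intToUnrCoeff (v.adicCompletion K) z := fun z ↦ by
    have hz := congrArg (fun φ : LTCoeff (v.adicCompletion K) →+* UnrCoeff (v.adicCompletion K) ↦ φ (LTCoeff.of (v.adicCompletion K) z)) (hj k)
    simpa only [RingHom.comp_apply, RingEquiv.toRingHom_eq_coe, RingHom.coe_coe, RingEquiv.symm_apply_apply] using hz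
  set e_v : ℂ := (εH.valueAtUniformizer v)⁻¹ * (((2 : ℕ) : ℂ))⁻¹ with he_vdef
  have hW : Θ (j k (algebraMap (LTCoeff (v.adicCompletion K)) (unitBall (E k)) (LTCoeff.of (v.adicCompletion K) (u : 𝒪[v.adicCompletion K])))) * Θ (j k (algebraMap (LTCoeff (v.adicCompletion K)) (unitBall (E k))
        (LTCoeff.of (v.adicCompletion K) ((u : 𝒪[v.adicCompletion K]) * ((2 : ℕ) : 𝒪[v.adicCompletion K]))))) ^ (m - 1) *
      ((ι.symm ψhat : PadicAlgCl 2) : ℂ_[2]) * ((ι.symm w𝔭 : PadicAlgCl 2) : ℂ_[2]) = ((ι.symm e_v : PadicAlgCl 2) : ℂ_[2]) := by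
    rw [hju, hju, he_vdef, hεv, inv_inv, hψhatdef]
    exact thetaC_euler_datum ι w₀.embedding he1 hf1 (hι w₀) hα₀0 u hu θ e₂ hΘe (by omega : 1 ≤ m) w𝔭
  /- §7. The class sums: `S₀` over the labels `T₀`, its transport to `T = (β₁)·T₀`, and the invariance `T ↦ 𝔭T` (-w2). -/
  obtain ⟨G, hGdef⟩ : ∃ G : Ideal (𝓞 K) → ℂ, ∀ 𝔞, G 𝔞 = 𝒲 𝔞 * ((Ideal.absNorm 𝔠 : ℂ) * (Lat 𝔞).eisensteinE m Ω - (Lat (𝔠 * 𝔞)).eisensteinE m Ω) :=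
    ⟨fun 𝔞 ↦ _, fun _ ↦ rfl⟩
  set S₀ : ℂ := ∑ 𝔟 ∈ T₀, 𝒲 𝔟 * ((Ideal.absNorm cI.1 : ℂ) * Ev 𝔟 - Ev (cI.1 * 𝔟)) with hS₀def
  set coefβ : ℂ := idealPow K χ (Ideal.span {β₁}) * idealPow K (fun w ↦ lam.valueAtUniformizer w) (Ideal.span {β₁}) ^ m
    with hcoefβdef
  have hcoefβ0 : coefβ ≠ 0 := by
    refine mul_ne_zero (fun h0 ↦ ?_) (pow_ne_zero _ (HeckeCharacter.idealPow_ne_zero (fun w ↦ lam.valueAtUniformizer_ne_zero' w) _))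
    have h1 := hχ.norm_idealPow h𝔪0 h𝔟₁0 h𝔟₁cop
    rw [h0, norm_zero] at h1
    exact zero_ne_one h1
  have h𝒲β : 𝒲 (Ideal.span {β₁}) = coefβ⁻¹ := by rw [h𝒲def, hcoefβdef, mul_inv]
  -- summand bookkeeping: `(S₀-summand at 𝔟) = coefβ · G((β₁)𝔟)`
  have hsummand : ∀ 𝔟 : Ideal (𝓞 K), 𝔟 ≠ ⊥ → 𝒲 𝔟 * ((Ideal.absNorm cI.1 : ℂ) * Ev 𝔟 - Ev (cI.1 * 𝔟)) = coefβ * G (Ideal.span {β₁} * 𝔟) := by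
    intro 𝔟 h𝔟
    rw [hGdef, hEvdef, hEvdef, h𝒲mul _ _ h𝔟₁0 h𝔟, h𝒲β, show cI.1 = 𝔠 from rfl, show Ideal.span {β₁} * (𝔠 * 𝔟) = 𝔠 * (Ideal.span {β₁} * 𝔟) by ring]
    field_simp
  have hS₀T : S₀ = coefβ * ∑ 𝔟 ∈ T, G 𝔟 := by
    rw [hS₀def, Finset.mul_sum, hTdef, sum_image_mul_left T₀ h𝔟₁0 (fun i ↦ coefβ * G i)]
    exact Finset.sum_congr rfl fun 𝔟 h𝔟 ↦ hsummand 𝔟 (hT₀reps.ne_bot_and_isCoprime 𝔟 h𝔟).1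
  have hST : ∑ 𝔟 ∈ T₀, 𝒲 𝔟 * ((Ideal.absNorm cI.1 : ℂ) * Ev 𝔟 - Ev (cI.1 * 𝔟)) = S₀ := rfl
  -- the invariance under `T ↦ 𝔭T` on the translated system (analytic, -w2)
  have hvcop : IsCoprime v.asIdeal (modulusIdeal (insert vbar S) (fun _ ↦ M)) := by
    rw [isCoprime_iff_forall_not_le h𝔪0]
    intro w hw hvw
    have hvw' := v.isMaximal.eq_of_le w.isPrime.ne_top hvw
    rw [← hvw'] at hw
    exact h𝔪v hw
  have hεu' : ∀ w : HeightOneSpectrum (𝓞 K), w ∉ insert vbar S → εH.IsUnramifiedAt w :=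
    fun w hw' ↦ hεunr w (fun h ↦ hw' (Finset.mem_insert_of_mem h)) (fun h ↦ hw' (h ▸ hvbarT))
  have hram : ∀ w : HeightOneSpectrum (𝓞 K), ¬ εH.IsUnramifiedAt w → w ∈ insert vbar S :=
    fun w hw' ↦ by by_contra h; exact hw' (hεu' w h)
  have hη := KatzJZeroRange.norm_apply_eq_ideleNorm_rpow_of_type_neg hεt hεu'
  have hTne : ∀ 𝔞 ∈ T, 𝔞 ≠ ⊥ := fun 𝔞 h𝔞 ↦ (hTreps.ne_bot_and_isCoprime 𝔞 h𝔞).1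
  have hTvne : ∀ 𝔞 ∈ T.image (v.asIdeal * ·), 𝔞 ≠ ⊥ := fun 𝔞 h𝔞 ↦
    ((hTreps.image_mul h𝔪0 v.ne_bot hvcop).ne_bot_and_isCoprime 𝔞 h𝔞).1
  have hsumv : ∑ 𝔞 ∈ T, G 𝔞 = ∑ 𝔞 ∈ T.image (v.asIdeal * ·), G 𝔞 := by
    simp only [hGdef, h𝒲def]
    exact DeShalit1987.sum_twist_eisensteinE_eq_sum_image_mul hK.1 w₀ hl hlmod h𝔪1 hw hχ hTreps h𝔠0 h𝔠cop v.ne_bot hvcop hΩ Lat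
      (fun 𝔞 h𝔞 ↦ hLat 𝔞 (hTne 𝔞 h𝔞)) (fun 𝔞 h𝔞 ↦ hLat _ (mul_ne_zero h𝔠0 (hTne 𝔞 h𝔞)))
      (fun 𝔞 h𝔞 ↦ hLat 𝔞 (hTvne 𝔞 h𝔞)) (fun 𝔞 h𝔞 ↦ hLat _ (mul_ne_zero h𝔠0 (hTvne 𝔞 h𝔞)))
      hη (KatzJZeroRange.one_lt_half_iff.mpr hm) hεu hram hL hm
  have hST𝔭 : ∑ 𝔟' ∈ T₀.image (v.asIdeal * ·), 𝒲 𝔟' * ((Ideal.absNorm cI.1 : ℂ) * Ev 𝔟' - Ev (cI.1 * 𝔟')) = S₀ := by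
    have hswap : ((v.asIdeal * ·) ∘ (Ideal.span {β₁} * ·) : Ideal (𝓞 K) → Ideal (𝓞 K)) = ((Ideal.span {β₁} * ·) ∘ (v.asIdeal * ·)) := funext fun 𝔞 ↦ by simp only [Function.comp_apply]; ring
    rw [sum_image_mul_left T₀ v.ne_bot (fun 𝔟' ↦ 𝒲 𝔟' * ((Ideal.absNorm cI.1 : ℂ) * Ev 𝔟' - Ev (cI.1 * 𝔟'))), hS₀T, hsumv, hTdef, Finset.image_image, hswap, ← Finset.image_image, sum_image_mul_left _ h𝔟₁0 G,
      sum_image_mul_left T₀ v.ne_bot (fun 𝔞 ↦ G (Ideal.span {β₁} * 𝔞)), Finset.mul_sum]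
    exact Finset.sum_congr rfl fun 𝔟 h𝔟 ↦ hsummand _ (mul_ne_zero v.ne_bot (hT₀reps.ne_bot_and_isCoprime 𝔟 h𝔟).1)
  /- §8. The result: lattices clauses, the degenerate twist `𝔠 = (1)`, and the seam identity. -/
  refine ⟨T, hTreps, fun 𝔟 h𝔟 ↦ hLat 𝔟 (hTne 𝔟 h𝔟), fun 𝔟 h𝔟 ↦ hLat _ (mul_ne_zero h𝔠0 (hTne 𝔟 h𝔟)), ?_⟩
  by_cases h𝔠1 : 𝔠 = ⊤
  · -- `N(1) − χ̃λ̃^m((1)) = 0` and every summand vanishes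
    subst h𝔠1
    have hL0 : ((Ideal.absNorm (⊤ : Ideal (𝓞 K)) : ℂ_[2]) - ((ι.symm (idealPow K χ ⊤ * idealPow K (fun w ↦ lam.valueAtUniformizer w) ⊤ ^ m) : PadicAlgCl 2) : ℂ_[2])) = 0 := by
      rw [Ideal.absNorm_top, idealPow_top, idealPow_top, one_pow, mul_one, map_one, Nat.cast_one, UniformSpace.Completion.coe_one, sub_self]
    have hR0 : ∑ 𝔟 ∈ T, (idealPow K χ 𝔟)⁻¹ * (idealPow K (fun w ↦ lam.valueAtUniformizer w) 𝔟 ^ m)⁻¹ * ((Ideal.absNorm (⊤ : Ideal (𝓞 K)) : ℂ) * (Lat 𝔟).eisensteinE m Ω - (Lat (⊤ * 𝔟)).eisensteinE m Ω) = 0 := by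
      refine Finset.sum_eq_zero fun 𝔟 _ ↦ ?_
      rw [Ideal.absNorm_top, Nat.cast_one, one_mul, Ideal.top_mul, sub_self, mul_zero]
    rw [hL0, hR0, zero_mul, mul_zero, map_zero, UniformSpace.Completion.coe_zero, mul_zero]
  -- the seam identity for the measure of record
  have hne𝔠 : avatarValueAt eH (g cI) ≠ (Ideal.absNorm cI.1 : ℂ_[2]) := by
    rw [hA9 cI]
    change ((ι.symm (idealPow K χ 𝔠 * idealPow K (fun w ↦ lam.valueAtUniformizer w) 𝔠 ^ m) : PadicAlgCl 2) : ℂ_[2]) ≠ (Ideal.absNorm 𝔠 : ℂ_[2])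
    intro h
    have hnat : ((Ideal.absNorm 𝔠 : PadicAlgCl 2) : ℂ_[2]) = (Ideal.absNorm 𝔠 : ℂ_[2]) := map_natCast (UniformSpace.Completion.coeRingHom : PadicAlgCl 2 →+* ℂ_[2]) _
    have h' : ι.symm (idealPow K χ 𝔠 * idealPow K (fun w ↦ lam.valueAtUniformizer w) 𝔠 ^ m) = (Ideal.absNorm 𝔠 : PadicAlgCl 2) := UniformSpace.Completion.coe_injective (PadicAlgCl 2) (h.trans hnat.symm)
    have h'' : idealPow K χ 𝔠 * idealPow K (fun w ↦ lam.valueAtUniformizer w) 𝔠 ^ m = (Ideal.absNorm 𝔠 : ℂ) := ι.symm.injective (h'.trans (map_natCast ι.symm _).symm)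
    exact KatzMeasureJZeroTop.absNorm_sub_classCoeff_ne_zero hK.1 w₀ hl hlmod hχ h𝔠0 h𝔠1 h𝔠cop hm (by rw [h'', sub_self])
  have hid := twist_mul_integral_eq_of_perUnit h24ii h24iii h25 hK w₀.embedding 𝔣 hle h𝔣0 h𝔣1 hvm hwm hq h2 u hσ₀ hε θ hθc
    hθ1 hθζ e₂ hΘe α hα0 hα𝔣 hαw f hαπ E hE hdegE hEE j hj hjC hjj ψ hψ
    (fun c : {c : Ideal (𝓞 K) // c ≠ ⊥ ∧ IsCoprime c (𝔣 0 * v.asIdeal)} ↦ c.1) (fun c ↦ c.2.1)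
    (fun c n ↦ isCoprime_chain 𝔣 𝔩 h𝔣succ hdiv c.2.2 n) g hg x hx (fun n ↦ ⟨𝔩 n, h𝔣succ n, hdiv n⟩) μ cI (hμ cI) k (m - 1)
    hχc hχmul h1 hne𝔠 hχG aL haL bL hbL cw hcw ι hinj hT₀ 𝒲 hχg w𝔭 h𝒲 A E₀ ψhat Ev hX hΦ e_v hW hST hST𝔭
  /- §9. Assemble: multiply by `−Θ(ε_ϑ)`, read `ê(g_𝔠)` through A9 and `S₀` through `coefβ`. -/
  rw [hA9 cI, hS₀T] at hid
  have hid' : (((ι.symm (idealPow K χ 𝔠 * idealPow K (fun w ↦ lam.valueAtUniformizer w) 𝔠 ^ m) : PadicAlgCl 2) : ℂ_[2]) - (Ideal.absNorm 𝔠 : ℂ_[2])) * μ.integral (fun σ ↦ avatarValueAt eH σ) = Θ (PowerSeries.coeff 1 (compSeriesC h2 hσ₀ u hε)) ^ (m - 1) *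
        (-12 * A * ((ι.symm ((1 - e_v) * (coefβ * ∑ 𝔟 ∈ T, G 𝔟)) : PadicAlgCl 2) : ℂ_[2])) := hid
  have hΘm : Θ (PowerSeries.coeff 1 (compSeriesC h2 hσ₀ u hε)) ^ m = Θ (PowerSeries.coeff 1 (compSeriesC h2 hσ₀ u hε)) * Θ (PowerSeries.coeff 1 (compSeriesC h2 hσ₀ u hε)) ^ (m - 1) := by
    conv_lhs => rw [← hm1, pow_succ']
  have hfold : ∑ 𝔟 ∈ T, (idealPow K χ 𝔟)⁻¹ * (idealPow K (fun w ↦ lam.valueAtUniformizer w) 𝔟 ^ m)⁻¹ * ((Ideal.absNorm 𝔠 : ℂ) * (Lat 𝔟).eisensteinE m Ω - (Lat (𝔠 * 𝔟)).eisensteinE m Ω) = ∑ 𝔟 ∈ T, G 𝔟 :=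
    Finset.sum_congr rfl fun 𝔟 _ ↦ by rw [hGdef, h𝒲def]
  rw [hfold, mul_pow, hΘm, map_mul ι.symm ((cβ ^ m)⁻¹), UniformSpace.Completion.coe_mul, map_mul ι.symm (1 - e_v),
    UniformSpace.Completion.coe_mul]
  rw [hAdef, map_mul ι.symm (1 - e_v), map_mul ι.symm coefβ, UniformSpace.Completion.coe_mul, UniformSpace.Completion.coe_mul]
    at hid'
  linear_combination (-(Θ (PowerSeries.coeff 1 (compSeriesC h2 hσ₀ u hε)))) * hid'

end Summit.BirchSwinnertonDyer.BirchSwinnertonDyer.Theorems.PrintCf2.KatzMeasureJZeroSeam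

end
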